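import Literature.NumberTheory.DiophantineGeometry.GenEllDeFamilySlopeDefect
import Literature.NumberTheory.DiophantineGeometry.GenEllDeBadPlaceDefectOfSplit
import Literature.NumberTheory.DiophantineGeometry.GenEllDeFamilyBadPrimesConverse
import Literature.NumberTheory.DiophantineGeometry.P1FiniteMapCuspMeeting
import Literature.NumberTheory.DiophantineGeometry.GenEllDeRamificationPadicFamily
import Literature.NumberTheory.DiophantineGeometry.GenEllDeCriticalValuesFamilyXphi
import Literature.NumberTheory.DiophantineGeometry.GenEllDeFibresPolynomial
import Literature.NumberTheory.DiophantineGeometry.SuperellipticHeightsFamilyJunction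
import HarnessLib

/-!
# [GenEll] Thm. 2.1 on the `D_e` route: the conductor bound `hκ` of the noncritical-Belyi mechanism
# (`GenEllMechanismKappa`, OWNER RULING #7 «R-b with defects», separation at `{∞, 2}` only)

S. Mochizuki, *Arithmetic elliptic curves in general position*, Math. J. Okayama Univ. 52 (2010),
Prop. 1.6 p. 10 (reduced divisor) as used in the proof of Thm. 2.1 pp. 12–13
[cite: MochizukiGenEll2010, Prop 1.6 p.10]. Support file for the route item `GenEllTwo`
(stmt-ABC-19679); assignment «GenEllMechanismKappa» of the package owner abc-iut-S6 to the W5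
coordinator abc-iut-w5-d045; classical, nothing here bears on [IUTchIII] Cor. 3.12.

THE `hκ` INPUT of abc-iut-w5-d075's `GenEllMechanismAssembly`, in its literal binder shape (STATUS
2026-08-26T03:30:44Z) with one extra degree binder. Data: `k ≥ 1` (`e = 2k+1`), `c ∈ ℚ^×`, a finite map
`φ = (f : g)` of `ℙ¹` with `deg f = deg g = deg(f − g) = n > 0` whose cusp fibre
`B = roots(f·g·(f−g))` contains the critical values of `t_c` and has at most `n + 2` elements
(noncritical Belyi count), and a number field `K` over which the critical-locus polynomial `R_c`
and `f·g·(f−g)` split. For every degree bound `N_d` and every `ρ > 0` there is ONE constant `C₂` such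
that for every number field `L ⊇ K` of degree `≤ N_d`, every point `(x, r)` of `D_e(L)` off the cusps,
the Weierstrass fibre and `φ⁻¹`-cusps, all of whose conjugates at `∞` and at `2` are `ρ`-far from the
roots of the bad polynomial `g_bad = Res_r(curvePoly, G_{f g (f−g)})`:

  `log-cond_{φ^*C}(t_c(x, r)) ≤ (((n + 2)(2k+4) − (6k+6))/(2k+1)) · ht(x) + C₂`.

Inside (all consumed BY NAME): the W5 core `DeC.slope_of_crit_sep_two_defect` (abc-iut-w5-d009's tree
version: good places = abc-iut-w5-d023's dichotomy with its reduction hypotheses discharged by this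
seat's `DeC.exists_badPrimes`, summation = the mixed form at `S₁ = {2}`), its converse input `hconvA`
from abc-iut-w5-d054's `DeC.hconv_off_badPrimes`; the meeting property `hW` from abc-iut-w5-d176's (J-B)
`exists_primes_root_ord_sub_pos`; the defect inequality at every odd bad prime from abc-iut-w5-d090's
(F-b) `DeC.exists_defect_toNat_ord_le_of_splits` (∘ abc-iut-w5-d054's (S1)); `2`-adic separation from
abc-iut-w5-d055's `DePadicC.exists_pos_le_norm_embedding_of_separated_of_subset`; the archimedean bound
from abc-iut-w5-d027's `DeFamily.exists_posLog_infinitePlace_le_of_XphiC_separated` (∘ abc-iut-w5-d015's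
`De.rootSet_resultant_eq_XphiC`); the heights from abc-iut-S4's
`Superelliptic.exists_junction_heights_of_rat`; `logCondDiv_eq_sum` (abc-iut-S4).
-/

noncomputable section

namespace Literature.NumberTheory.DiophantineGeometry.GenEll

open _root_.Polynomial NumberField IsDedekindDomain
open Literature.IUT.LogVolume

/-! ## Small helpers -/

/-- `h(x) ≥ 0` for the Weil height of a number field element. [folklore] -/
private theorem logHeight₁_nonneg' {L : Type*} [Field L] [NumberField L] (x : L) :
    0 ≤ Height.logHeight₁ x := by
  rw [Height.logHeight₁_eq_log_mulHeight₁]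
  exact Real.log_nonneg (Height.one_le_mulHeight₁ _)

/-- An integer polynomial evaluates through a ring homomorphism: `τ (m(a)) = m(τ a)`. [folklore] -/
private theorem map_aeval_intPoly {R S : Type*} [CommRing R] [CommRing S] (τ : R →+* S) (m : ℤ[X])
    (a : R) : τ (aeval a m) = aeval (τ a) m := by
  rw [aeval_def, aeval_def, Polynomial.hom_eval₂]
  congr 1
  exact RingHom.ext_int _ _

/-- An integer polynomial read over `ℚ` evaluates as the integer polynomial. [folklore] -/
private theorem aeval_map_intCast {S : Type*} [Field S] [CharZero S] (m : ℤ[X]) (y : S) :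
    aeval y (m.map (Int.castRingHom ℚ)) = aeval y m := by
  rw [← algebraMap_int_eq, aeval_map_algebraMap]

/-- The roots of `m ∈ ℤ[X]` read in `R`: `a` is a root iff `m(a) = 0` (for `m ≠ 0`). [folklore] -/
private theorem mem_roots_map_intCast_iff {R : Type*} [CommRing R] [IsDomain R] [CharZero R]
    {m : ℤ[X]} (hm : m ≠ 0) (a : R) :
    a ∈ (m.map (Int.castRingHom R)).roots ↔ aeval a m = 0 := by
  rw [mem_roots ((Polynomial.map_ne_zero_iff (Int.castRingHom R).injective_int).mpr hm), IsRoot.def,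
    eval_map, ← algebraMap_int_eq, ← aeval_def]

/-! ## The conductor bound of the mechanism -/

open scoped Classical in
/-- **`hκ` of the noncritical-Belyi mechanism** ([GenEll] Prop. 1.6, sharp form on the cover `D_e`,
summed over all places; OWNER RULING #7: separation at `{∞, 2}` only, defects at every other bad prime).
See the module docstring for the data; the conclusion is abc-iut-w5-d075's literal binder (with the
degree bound `[L:ℚ] ≤ N_d` added, needed by the `2`-adic separation supplier).
[cite: MochizukiGenEll2010, Prop 1.6 p.10] -/
theorem exists_condBound_mechanism (k : ℕ) (hk : 1 ≤ k) {c : ℚ} (hc : c ≠ 0) (φ : P1FiniteMap)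
    (hdeg : 0 < φ.deg) (hnum : φ.num.natDegree = φ.deg) (hden : φ.den.natDegree = φ.deg)
    (hsub : (φ.num - φ.den).natDegree = φ.deg)
    (hAB : ∀ a ∈ DeCrit.critSetC k c, aeval a (φ.num * φ.den * (φ.num - φ.den)) = 0)
    (hcard : ((φ.num * φ.den * (φ.num - φ.den)).map (Int.castRingHom ℂ)).roots.toFinset.card ≤
      φ.deg + 2)
    (K : Type) [Field K] [NumberField K] (hKR : (DeCrit.RpolyC k (c : K)).Splits)
    (hKB : ((φ.num * φ.den * (φ.num - φ.den)).map (Int.castRingHom K)).Splits)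
    (Nd : ℕ) {ρ : ℝ} (hρ : 0 < ρ) :
    ∃ C₂ : ℝ, ∀ (L : Type) [Field L] [NumberField L] [Algebra K L], Module.finrank ℚ L ≤ Nd →
      ∀ (x r : L), r ^ (2 * k + 1) = x * (1 - x) → x ≠ 0 → x ≠ 1 → r ≠ 0 → 1 - 2 * x ≠ 0 →
      ((φ.num * φ.den * (φ.num - φ.den)).map (Int.castRingHom L)).Splits →
      aeval (DeCrit.tC k (algebraMap ℚ L c) x r) (φ.num * φ.den * (φ.num - φ.den)) ≠ 0 →
      (∀ σ : L →+* ℂ, ∀ a ∈ (resultant (De.curvePoly k) (De.homFibrePolyC k c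
        (φ.num.map (Int.castRingHom ℚ) * φ.den.map (Int.castRingHom ℚ) *
          (φ.num.map (Int.castRingHom ℚ) - φ.den.map (Int.castRingHom ℚ))))).aroots ℂ,
        ρ < ‖σ x - a‖) →
      (∀ σ : L →+* PadicAlgCl 2, ∀ a ∈ (resultant (De.curvePoly k) (De.homFibrePolyC k c
        (φ.num.map (Int.castRingHom ℚ) * φ.den.map (Int.castRingHom ℚ) *
          (φ.num.map (Int.castRingHom ℚ) - φ.den.map (Int.castRingHom ℚ))))).aroots (PadicAlgCl 2),
        ρ < ‖σ x - a‖) →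
      (⟨L, DeCrit.tC k (algebraMap ℚ L c) x r⟩ : NFPoint).logCondDiv φ.pullbackCusps ≤
        (((φ.deg : ℝ) + 2) * (2 * k + 4) - (6 * k + 6)) / (2 * k + 1) * (⟨L, x⟩ : NFPoint).ht + C₂ := by
  classical
  -- the cusp-fibre polynomial `m = f·g·(f−g)` and the bad polynomial `g_bad`
  set mZ : ℤ[X] := φ.num * φ.den * (φ.num - φ.den) with hmZ
  set mQ : ℚ[X] := φ.num.map (Int.castRingHom ℚ) * φ.den.map (Int.castRingHom ℚ) *
    (φ.num.map (Int.castRingHom ℚ) - φ.den.map (Int.castRingHom ℚ)) with hmQ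
  have hmQ_eq : mQ = mZ.map (Int.castRingHom ℚ) := by
    simp only [hmQ, hmZ, Polynomial.map_mul, Polynomial.map_sub]
  have hmZ0 : mZ ≠ 0 := by
    have hinj : Function.Injective (Int.castRingHom ℚ) := (Int.castRingHom ℚ).injective_int
    have hpn : (φ.num.map (Int.castRingHom ℚ)).natDegree = φ.deg := by
      rw [natDegree_map_eq_of_injective hinj, hnum]
    have hqn : (φ.den.map (Int.castRingHom ℚ)).natDegree = φ.deg := by
      rw [natDegree_map_eq_of_injective hinj, hden]
    have hpqn : (φ.num.map (Int.castRingHom ℚ) - φ.den.map (Int.castRingHom ℚ)).natDegree = φ.deg := by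
      rw [← Polynomial.map_sub, natDegree_map_eq_of_injective hinj, hsub]
    have hp0 : φ.num.map (Int.castRingHom ℚ) ≠ 0 := fun h => by rw [h, natDegree_zero] at hpn; omega
    have hq0 : φ.den.map (Int.castRingHom ℚ) ≠ 0 := fun h => by rw [h, natDegree_zero] at hqn; omega
    have hpq0 : φ.num.map (Int.castRingHom ℚ) - φ.den.map (Int.castRingHom ℚ) ≠ 0 := fun h => by
      rw [h, natDegree_zero] at hpqn; omega
    intro h0
    have : mQ = 0 := by rw [hmQ_eq, h0, Polynomial.map_zero]
    exact mul_ne_zero (mul_ne_zero hp0 hq0) hpq0 this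
  have hmQ0 : mQ ≠ 0 := by
    rw [hmQ_eq]; exact (Polynomial.map_ne_zero_iff (Int.castRingHom ℚ).injective_int).mpr hmZ0
  set gbad : ℚ[X] := resultant (De.curvePoly k) (De.homFibrePolyC k c mQ) with hgbad
  -- the fixed field `K`: the parameter, the critical values `A`, the cusp fibre `B_K`
  set cK : K := (c : K) with hcK_def
  have hcK : cK ≠ 0 := by rw [hcK_def]; exact_mod_cast hc
  have h2K : (2 : K) ≠ 0 := two_ne_zero
  set A : Finset K := (DeCrit.RpolyC k cK).roots.toFinset.image (DeCrit.tCritC k cK) with hA_def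
  have hA : ∀ θ : K, (DeCrit.RpolyC k cK).eval θ = 0 → DeCrit.tCritC k cK θ ∈ A := by
    intro θ hθ
    refine Finset.mem_image.mpr ⟨θ, ?_, rfl⟩
    exact Multiset.mem_toFinset.mpr ((mem_roots (DeCrit.RpolyC_ne_zero k cK)).mpr hθ)
  have hcritA : ∀ θ : K, (DeCrit.RpolyC k cK).eval θ = 0 →
      ((1 - 2 * DeCrit.critXC k cK θ) + cK * θ ^ (k + 2)) / (θ * (1 - 2 * DeCrit.critXC k cK θ)) ∈ A := by
    intro θ hθ
    have e : ((1 - 2 * DeCrit.critXC k cK θ) + cK * θ ^ (k + 2)) / (θ * (1 - 2 * DeCrit.critXC k cK θ))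
        = DeCrit.tC k cK (DeCrit.critXC k cK θ) θ := rfl
    rw [e, DeCrit.tC_critPointC h2K]
    exact hA θ hθ
  set BK : Finset K := (mZ.map (Int.castRingHom K)).roots.toFinset with hBK_def
  -- an embedding `τ : K → ℂ` transports `A ⊆ critSetC ⊆ roots(m)` to `K`
  obtain ⟨w₀⟩ := (inferInstance : Nonempty (InfinitePlace K))
  set τ : K →+* ℂ := w₀.embedding with hτ
  have hτc : τ cK = (c : ℂ) := by rw [hcK_def, map_ratCast]
  have hAm : ∀ θ : K, (DeCrit.RpolyC k cK).eval θ = 0 → aeval (DeCrit.tCritC k cK θ) mZ = 0 := by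
    intro θ hθ
    have hθℂ : (DeCrit.RpolyC k (c : ℂ)).eval (τ θ) = 0 := by
      rw [← hτc, DeCrit.eval_RpolyC_map, hθ, map_zero]
    have hmem : τ (DeCrit.tCritC k cK θ) ∈ DeCrit.critSetC k c := by
      rw [DeCrit.mem_critSetC_iff]
      refine ⟨τ θ, hθℂ, ?_⟩
      rw [← DeCrit.tC_critPointC h2K, ← DeCrit.tC_critPointC two_ne_zero, ← hτc]
      letI : Algebra K ℂ := τ.toAlgebra
      have h := DeC.algebraMap_critValue k (L := ℂ) cK θ
      exact h.symm
    have h := hAB _ hmem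
    rw [← map_aeval_intPoly τ mZ] at h
    exact (map_eq_zero_iff τ τ.injective).mp h
  have hABK : A ⊆ BK := by
    intro a ha
    obtain ⟨θ, hθ, rfl⟩ := Finset.mem_image.mp ha
    have hθ' : (DeCrit.RpolyC k cK).eval θ = 0 :=
      (mem_roots (DeCrit.RpolyC_ne_zero k cK)).mp (Multiset.mem_toFinset.mp hθ)
    exact Multiset.mem_toFinset.mpr ((mem_roots_map_intCast_iff hmZ0 _).mpr (hAm θ hθ'))
  have hBKcard : BK.card ≤ φ.deg + 2 := by
    have hsub' : BK.map ⟨τ, τ.injective⟩ ⊆ (mZ.map (Int.castRingHom ℂ)).roots.toFinset := by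
      intro b hb
      obtain ⟨b₀, hb₀, rfl⟩ := Finset.mem_map.mp hb
      have h0 : aeval b₀ mZ = 0 :=
        (mem_roots_map_intCast_iff hmZ0 _).mp (Multiset.mem_toFinset.mp hb₀)
      refine Multiset.mem_toFinset.mpr ((mem_roots_map_intCast_iff hmZ0 _).mpr ?_)
      change aeval (τ b₀) mZ = 0
      rw [← map_aeval_intPoly τ mZ, h0, map_zero]
    calc BK.card = (BK.map ⟨τ, τ.injective⟩).card := (Finset.card_map _).symm
      _ ≤ ((mZ.map (Int.castRingHom ℂ)).roots.toFinset).card := Finset.card_le_card hsub'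
      _ ≤ φ.deg + 2 := hcard
  -- CONSTANTS. (1) the W5 core: good places off `S`, summation
  obtain ⟨S, h2S, hSp, hcore⟩ := DeC.slope_of_crit_sep_two_defect (K := K) k hcK A
  -- (1b) the converse at the critical values off `S₂` (abc-iut-w5-d054)
  obtain ⟨S₂, -, hS₂p, hconv⟩ := DeC.hconv_off_badPrimes (K := K) k hcK A hKR hcritA
  -- (2) J-B: the bad primes of `φ`
  obtain ⟨SJ, hSJp, hJB⟩ := φ.exists_primes_root_ord_sub_pos hnum hden hsub hmZ0
  set T : Finset ℕ := (S ∪ S₂) ∪ SJ with hT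
  have hST : S ⊆ T := Finset.subset_union_left.trans Finset.subset_union_left
  have hS₂T : S₂ ⊆ T := Finset.subset_union_right.trans Finset.subset_union_left
  have hSJT : SJ ⊆ T := Finset.subset_union_right
  have hTp : ∀ p ∈ T, p.Prime := by
    intro p hp
    rcases Finset.mem_union.mp hp with h | h
    · rcases Finset.mem_union.mp h with h' | h'
      · exact hSp p h'
      · exact hS₂p p h'
    · exact hSJp p h
  -- (3) F-b: one defect per prime
  have hdefp : ∀ p : ℕ, p.Prime → ∃ D : ℕ, ∀ (L : Type) [Field L] [NumberField L] [Algebra K L]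
      (w : HeightOneSpectrum (𝓞 L)), w ∈ placesOver L p → ∀ (r s t N : L),
      s ^ 2 = 1 - 4 * r ^ (2 * k + 1) → t * (r * s) = s + algebraMap K L cK * r ^ (k + 2) →
      N = -s ^ 3 + algebraMap K L cK * ((k + 1) * r ^ (k + 2) - 2 * r ^ (3 * k + 3)) →
      r ≠ 0 → s ≠ 0 → N ≠ 0 → (∀ β ∈ A, t ≠ algebraMap K L β) →
      (ord L w N).toNat ≤ (∑ β ∈ A, (ord L w (t - algebraMap K L β)).toNat) + D * ramIdx L w := by
    intro p hp
    haveI : Fact p.Prime := ⟨hp⟩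
    exact DeC.exists_defect_toNat_ord_le_of_splits p k hk hcK A hKR hA
  choose! Dfun hDfun using hdefp
  -- (4) `2`-adic separation (degree-bounded supplier)
  obtain ⟨c₀, hc₀, hpad⟩ :=
    DePadicC.exists_pos_le_norm_embedding_of_separated_of_subset (p := 2) k Nd hc hρ
  obtain ⟨k₂, hk₂⟩ : ∃ k₂ : ℕ, ((2 : ℝ) ^ k₂)⁻¹ ≤ c₀ := by
    obtain ⟨n, hn⟩ := exists_pow_lt_of_lt_one hc₀ (by norm_num : (1 / 2 : ℝ) < 1)
    refine ⟨n, ?_⟩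
    rw [one_div_pow] at hn
    rw [← one_div]
    exact hn.le
  -- (5) archimedean separation
  obtain ⟨C₃, -, harchC⟩ := DeFamily.exists_posLog_infinitePlace_le_of_XphiC_separated k hc hρ
  -- (6) heights of `t_c` and `N_c`
  obtain ⟨C₄, C₅, hheights⟩ := Superelliptic.exists_junction_heights_of_rat k hk c hc
  -- (7) heights of the cusp fibre
  set C₆ : ℝ := ∑ b ∈ BK, (Module.finrank ℚ K : ℝ)⁻¹ * Height.logHeight₁ b with hC₆
  refine ⟨(BK.card * C₄ + C₅) / (2 * k + 1) + BK.card * (C₆ + Real.log 2) +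
    (((k₂ : ℝ) * Real.log 2) + ∑ p ∈ T.erase 2, (Dfun p : ℝ) * Real.log p) +
    (Real.log 2 + ∑ p ∈ T.erase 2, Real.log p) + C₃, ?_⟩
  -- THE POINT
  intro L _ _ _ hL x r hcurve hx0 hx1 hr hs hsplL hOff hfarℂ hfar₂
  set cL : L := algebraMap ℚ L c with hcL_def
  have hcL : cL = (c : L) := by rw [hcL_def]; exact eq_ratCast _ c
  have hιc : algebraMap K L cK = cL := by rw [hcK_def, map_ratCast, hcL]
  have hcL0 : cL ≠ 0 := by rw [hcL]; exact_mod_cast hc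
  have h2L : (2 : L) ≠ 0 := two_ne_zero
  have heL : ((2 * k + 1 : ℕ) : L) ≠ 0 := Nat.cast_ne_zero.mpr (by omega)
  set s : L := 1 - 2 * x with hs_def
  set t : L := DeCrit.tC k cL x r with ht_def
  set N : L := -s ^ 3 + algebraMap K L cK * ((k + 1) * r ^ (k + 2) - 2 * r ^ (3 * k + 3)) with hN_def
  have hcurve' : s ^ 2 = 1 - 4 * r ^ (2 * k + 1) := by
    rw [hs_def]; linear_combination (4 : L) * hcurve
  have hrs : r * s ≠ 0 := mul_ne_zero hr hs
  have ht : t * (r * s) = s + algebraMap K L cK * r ^ (k + 2) := by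
    rw [hιc, ht_def, DeCrit.tC, hs_def, div_mul_cancel₀ _ hrs]
  -- the cusp fibre over `L` is the image of `B_K`
  set B : Finset L := BK.map ⟨algebraMap K L, (algebraMap K L).injective⟩ with hB_def
  have hmapL : mZ.map (Int.castRingHom L) = (mZ.map (Int.castRingHom K)).map (algebraMap K L) := by
    rw [Polynomial.map_map]
    congr 1
    exact RingHom.ext_int _ _
  have hrootsL : (mZ.map (Int.castRingHom L)).roots.toFinset = B := by
    rw [hmapL, hKB.roots_map (algebraMap K L), Multiset.toFinset_map, hB_def, Finset.map_eq_image]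
    rfl
  have hAB' : A.map ⟨algebraMap K L, (algebraMap K L).injective⟩ ⊆ B :=
    Finset.map_subset_map.mpr hABK
  have hBroot : ∀ b ∈ B, aeval b mZ = 0 := by
    intro b hb
    rw [← hrootsL] at hb
    exact (mem_roots_map_intCast_iff hmZ0 _).mp (Multiset.mem_toFinset.mp hb)
  have htB : ∀ b ∈ B, t ≠ b := by
    intro b hb htb
    exact hOff (by rw [htb]; exact hBroot b hb)
  have htA : ∀ a ∈ A, t ≠ algebraMap K L a := fun a ha =>
    htB (algebraMap K L a) (hAB' (Finset.mem_map_of_mem _ ha))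
  -- `N ≠ 0`: a zero of `N_c` has `t_c`-value a critical value, hence a root of `m`
  have hN0 : N ≠ 0 := by
    intro hN0
    have hNv : DeCrit.NvalC k cL (x, r) = 0 := by
      have e : DeCrit.NvalC k cL (x, r) = N := by rw [hN_def, DeCrit.NvalC_eq, hιc, hs_def]
      rw [e, hN0]
    have hcurveP : r ^ (2 * k + 1) = x * (1 - x) := hcurve
    have hx : x = DeCrit.critXC k cL r := DeCrit.fst_eq_critXC_of_NvalC_eq_zero k h2L heL hcL0 hcurveP hNv
    have hR : (DeCrit.RpolyC k cL).eval r = 0 := DeCrit.eval_RpolyC_eq_zero_of_NvalC_eq_zero k cL hcurveP hNv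
    obtain ⟨θ₀, hθ₀, hθ₀r⟩ := DeC.exists_root_eq_algebraMap (K := K) k hKR (L := L) (θ := r)
      (by rw [hιc]; exact hR)
    have htval : t = algebraMap K L (((1 - 2 * DeCrit.critXC k cK θ₀) + cK * θ₀ ^ (k + 2)) /
        (θ₀ * (1 - 2 * DeCrit.critXC k cK θ₀))) := by
      rw [DeC.algebraMap_critValue k (L := L) cK θ₀, hιc, hθ₀r, ← hx, ht_def, DeCrit.tC]
    exact htA _ (hcritA θ₀ hθ₀) htval
  -- the conductor support `W`
  let Qt : NFPoint := ⟨L, t⟩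
  have hOff' : Qt.OffDiv φ.pullbackCusps := hOff
  set W : Finset (HeightOneSpectrum (𝓞 L)) := (Qt.condSupportDiv_finite hOff').toFinset with hW_def
  -- (hW) meeting property off the bad primes of `φ` (J-B)
  have hW : ∀ w ∈ W, w ∉ T.attach.biUnion (fun p => placesOver L p.1) →
      ∃ b ∈ B, 0 < ord L w (t - b) := by
    intro w hw hwT
    have hw' : w ∈ Qt.condSupportDiv φ.pullbackCusps := (Set.Finite.mem_toFinset _).mp hw
    have hwSJ : w ∉ SJ.attach.biUnion (fun p => placesOver L p.1) := by
      intro h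
      obtain ⟨p, -, hp⟩ := Finset.mem_biUnion.mp h
      exact hwT (Finset.mem_biUnion.mpr ⟨⟨p.1, hSJT p.2⟩, Finset.mem_attach _ _, hp⟩)
    have hsplQ : (φ.pullbackCusps.poly.map (Int.castRingHom Qt.F)).Splits := hsplL
    obtain ⟨b, hb, hpos⟩ := hJB Qt hOff' hsplQ w hw' hwSJ
    refine ⟨b, ?_, hpos⟩
    rw [← hrootsL]
    exact hb
  -- (hsep) `2`-adic separation in embedding currency
  have hsep : ∀ σ : L →+* PadicAlgCl 2, ((2 : ℝ) ^ k₂)⁻¹ ≤ ‖σ N‖ := by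
    intro σ
    -- the zeros of `N_c` over `ℚ̄₂` have `x`-coordinate a root of `g_bad`
    let Ω := PadicAlgCl 2
    let Z : Set (Ω × Ω) := {Q | Q.1 ∈ gbad.rootSet Ω}
    have hZ : ∀ Q : Ω × Ω, Q.2 ^ (2 * k + 1) = Q.1 * (1 - Q.1) →
        -(1 - 2 * Q.1) ^ 3 + (c : Ω) * (((k : Ω) + 1) * Q.2 ^ (k + 2) - 2 * Q.2 ^ (3 * k + 3)) = 0 →
        Q ∈ Z := by
      intro Q hQc hQN
      have hcΩ : (c : Ω) ≠ 0 := by exact_mod_cast hc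
      have h2Ω : (2 : Ω) ≠ 0 := two_ne_zero
      have heΩ : ((2 * k + 1 : ℕ) : Ω) ≠ 0 := Nat.cast_ne_zero.mpr (by omega)
      have hNv : DeCrit.NvalC k (c : Ω) Q = 0 := by rw [DeCrit.NvalC_eq]; exact hQN
      have hx : Q.1 = DeCrit.critXC k (c : Ω) Q.2 :=
        DeCrit.fst_eq_critXC_of_NvalC_eq_zero k h2Ω heΩ hcΩ (x := Q.1) (r := Q.2) hQc hNv
      have hR : (DeCrit.RpolyC k (c : Ω)).eval Q.2 = 0 :=
        DeCrit.eval_RpolyC_eq_zero_of_NvalC_eq_zero k (c : Ω) (x := Q.1) (r := Q.2) hQc hNv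
      have hden := DeCrit.tDen_critPointC_ne_zero k h2Ω heΩ hcΩ hR
      rw [← hx] at hden
      -- transport the critical value from `K`
      let κ : K →+* Ω := (IsAlgClosed.lift : K →ₐ[ℚ] Ω).toRingHom
      letI : Algebra K Ω := κ.toAlgebra
      have hκ : algebraMap K Ω = κ := rfl
      have hκc : algebraMap K Ω cK = (c : Ω) := by rw [hκ, hcK_def, map_ratCast]
      obtain ⟨θ₀, hθ₀, hθ₀r⟩ := DeC.exists_root_eq_algebraMap (K := K) k hKR (L := Ω) (θ := Q.2)
        (by rw [hκc]; exact hR)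
      have htval : DeCrit.tC k (c : Ω) Q.1 Q.2 =
          κ (((1 - 2 * DeCrit.critXC k cK θ₀) + cK * θ₀ ^ (k + 2)) /
            (θ₀ * (1 - 2 * DeCrit.critXC k cK θ₀))) := by
        rw [← hκ, DeC.algebraMap_critValue k (L := Ω) cK θ₀, hκc, hθ₀r, ← hx]
        rfl
      have hroot : aeval (DeCrit.tC k (c : Ω) Q.1 Q.2) mZ = 0 := by
        have h0 : aeval (DeCrit.tCritC k cK θ₀) mZ = 0 := hAm θ₀ hθ₀
        have h1 : κ (aeval (DeCrit.tCritC k cK θ₀) mZ) = 0 := by rw [h0, map_zero]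
        rw [map_aeval_intPoly κ mZ] at h1
        have e : DeCrit.tC k (c : Ω) Q.1 Q.2 = κ (DeCrit.tCritC k cK θ₀) := by
          rw [htval, ← DeCrit.tC_critPointC h2K]
          rfl
        rw [e]
        exact h1
      change Q.1 ∈ gbad.rootSet Ω
      rw [hgbad, De.rootSet_resultant_homFibrePolyC k hc hmQ0]
      refine ⟨Q.2, hQc, (mul_ne_zero_iff.mp hden).1, (mul_ne_zero_iff.mp hden).2, ?_⟩
      rw [hmQ_eq, aeval_map_intCast, eq_ratCast]
      exact hroot
    have hfarZ : ∀ Q ∈ Z, ρ ≤ dist (σ x, σ r) Q := by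
      intro Q hQ
      have hQ' : Q.1 ∈ gbad.aroots Ω := by
        have h := hQ
        change Q.1 ∈ gbad.rootSet Ω at h
        rw [mem_rootSet'] at h
        exact mem_aroots'.mpr h
      have h := (hfar₂ σ Q.1 hQ').le
      calc ρ ≤ ‖σ x - Q.1‖ := h
        _ = dist (σ x) Q.1 := (dist_eq_norm _ _).symm
        _ ≤ dist (σ x, σ r) Q := by rw [Prod.dist_eq]; exact le_max_left _ _
    have h := hpad Z hZ L hL x r hcurve σ hfarZ
    have eN : N = -(1 - 2 * x) ^ 3 + (c : L) * (((k : L) + 1) * r ^ (k + 2) - 2 * r ^ (3 * k + 3)) := by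
      rw [hN_def, hιc, hcL, hs_def]
    rw [eN]
    exact hk₂.trans h
  -- (hδ) the defect at the odd bad primes (F-b), lifted from `A` to `B`
  have hδ : ∀ p ∈ T, p ≠ 2 → ∀ w ∈ placesOver L p,
      (ord L w N).toNat ≤ (∑ b ∈ B, (ord L w (t - b)).toNat) + Dfun p * ramIdx L w := by
    intro p hpT _ w hw
    have h := hDfun p (hTp p hpT) L w hw r s t N hcurve' ht rfl hr hs hN0 htA
    have hle : ∑ β ∈ A, (ord L w (t - algebraMap K L β)).toNat ≤
        ∑ b ∈ B, (ord L w (t - b)).toNat := by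
      have e : ∑ β ∈ A, (ord L w (t - algebraMap K L β)).toNat =
          ∑ b ∈ A.map ⟨algebraMap K L, (algebraMap K L).injective⟩, (ord L w (t - b)).toNat := by
        rw [Finset.sum_map]; rfl
      rw [e]
      exact Finset.sum_le_sum_of_subset_of_nonneg hAB' fun _ _ _ => Nat.zero_le _
    omega
  -- (harch) archimedean separation
  have harch : ∀ v : InfinitePlace L, Real.posLog (v N⁻¹) ≤ C₃ := by
    intro v
    set Bℂ : Finset ℂ := (mQ.aroots ℂ).toFinset with hBℂ
    have hBℂcrit : DeCrit.critSetC k c ⊆ Bℂ := by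
      intro a ha
      refine Multiset.mem_toFinset.mpr (mem_aroots'.mpr ⟨?_, ?_⟩)
      · exact (Polynomial.map_ne_zero_iff (algebraMap ℚ ℂ).injective).mpr hmQ0
      · rw [hmQ_eq, aeval_map_intCast]; exact hAB a ha
    have hsepv : ∀ a ∈ De.XphiC k (c : ℂ) Bℂ, ρ ≤ ‖v.embedding x - a‖ := by
      intro a ha
      have hroot : a ∈ gbad.rootSet ℂ := by
        rw [hgbad, De.rootSet_resultant_eq_XphiC k hc hmQ0, eq_ratCast]
        exact ha
      have ha' : a ∈ gbad.aroots ℂ := by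
        rw [mem_rootSet'] at hroot; exact mem_aroots'.mpr hroot
      exact (hfarℂ v.embedding a ha').le
    have h := harchC Bℂ hBℂcrit L x r hcurve v hsepv
    have eN : DeFamily.N k (c : L) (x, r) = N := by
      rw [DeFamily.N_eq_mul_sub, hN_def, hιc, hcL, hs_def]; ring
    rw [eN] at h
    rw [map_inv₀]
    exact h
  -- (htH, hNH) heights
  have hN' : N = -s ^ 3 + (c : L) * (((k : L) + 1) * r ^ (k + 2) - 2 * r ^ (3 * k + 3)) := by
    rw [hN_def, hιc, hcL]
  have ht' : t * (r * s) = s + (c : L) * r ^ (k + 2) := by rw [← hcL, ← hιc]; exact ht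
  obtain ⟨htH, hNH⟩ := hheights L x r s t N rfl hcurve hx0 hx1 hs ht' hN'
  -- (hBH) heights of the cusp fibre
  have hBH : ∀ b ∈ B, Height.logHeight₁ b ≤ Module.finrank ℚ L * C₆ := by
    intro b hb
    obtain ⟨b₀, hb₀, rfl⟩ := Finset.mem_map.mp hb
    have hK : (0 : ℝ) < Module.finrank ℚ K := Nat.cast_pos.mpr Module.finrank_pos
    have h := NumberField.logHeight₁_map_ringHom (algebraMap K L) b₀
    have e : Height.logHeight₁ (algebraMap K L b₀) =
        Module.finrank ℚ L * ((Module.finrank ℚ K : ℝ)⁻¹ * Height.logHeight₁ b₀) := by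
      field_simp
      linarith
    have hle : (Module.finrank ℚ K : ℝ)⁻¹ * Height.logHeight₁ b₀ ≤ C₆ := by
      rw [hC₆]
      exact Finset.single_le_sum (f := fun b => (Module.finrank ℚ K : ℝ)⁻¹ * Height.logHeight₁ b)
        (fun b _ => mul_nonneg (inv_nonneg.mpr (Nat.cast_nonneg _)) (logHeight₁_nonneg' b)) hb₀
    change Height.logHeight₁ (algebraMap K L b₀) ≤ _
    rw [e]
    exact mul_le_mul_of_nonneg_left hle (Nat.cast_nonneg _)
  -- (hconvA) the converse at the critical values off `T ⊇ S₂`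
  have hconvA : ∀ w : HeightOneSpectrum (𝓞 L), w ∉ T.attach.biUnion (fun p => placesOver L p.1) →
      w.valuation L N < 1 →
        ∃ a ∈ A.map ⟨algebraMap K L, (algebraMap K L).injective⟩, w.valuation L (t - a) < 1 :=
    fun w hw hN1 => hconv L T hS₂T w hw hcurve' ht rfl hN1
  -- THE CORE
  have key := hcore L T hST hTp hcurve' ht rfl hN0 B hAB' htB W k₂ Dfun
    (C₃ := C₃) (C₄ := C₄) (C₅ := C₅) (C₆ := C₆) hconvA hW hsep hδ harch htH hNH hBH
  -- conversion to `logCondDiv` and `ht`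
  have hLHS : Qt.logCondDiv φ.pullbackCusps =
      (Module.finrank ℚ L : ℝ)⁻¹ * ∑ w ∈ W, logNorm L w := by
    rw [NFPoint.logCondDiv_eq_sum Qt hOff']
    rfl
  have hht : (⟨L, x⟩ : NFPoint).ht = (Module.finrank ℚ L : ℝ)⁻¹ * Height.logHeight₁ x := rfl
  have hht0 : 0 ≤ (Module.finrank ℚ L : ℝ)⁻¹ * Height.logHeight₁ x :=
    mul_nonneg (inv_nonneg.mpr (Nat.cast_nonneg _)) (logHeight₁_nonneg' x)
  have hBcard : (B.card : ℝ) = BK.card := by rw [hB_def, Finset.card_map]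
  have hBKle : (BK.card : ℝ) ≤ φ.deg + 2 := by exact_mod_cast hBKcard
  have hk0 : (0 : ℝ) < 2 * k + 1 := by positivity
  have hslope : ((BK.card * (2 * k + 4 : ℝ) - (6 * k + 6)) / (2 * k + 1)) *
      ((Module.finrank ℚ L : ℝ)⁻¹ * Height.logHeight₁ x) ≤
      (((φ.deg : ℝ) + 2) * (2 * k + 4) - (6 * k + 6)) / (2 * k + 1) *
        ((Module.finrank ℚ L : ℝ)⁻¹ * Height.logHeight₁ x) := by
    refine mul_le_mul_of_nonneg_right ?_ hht0
    refine div_le_div_of_nonneg_right ?_ hk0.le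
    nlinarith
  change Qt.logCondDiv φ.pullbackCusps ≤ _
  rw [hLHS, hht]
  rw [hBcard] at key
  linarith


/-- **The `hKappa` hypothesis of `mechanismFor_of_kappa` (`GenEllMechanismFor`) for the menu parameters of
the closing composition** (`k ≥ 3`, `c = 2^j`): the conductor bound `exists_condBound_mechanism`, repackaged
with the two front hypotheses `1 ≤ k`, `c ≠ 0` discharged — so that the route's closer composes
`mechanismFor_of_kappa … (hKappa_of_pow_two k hk hc)` with no adapter.
[cite: MochizukiGenEll2010, Thm 2.1 proof pp.12-13] -/
theorem hKappa_of_pow_two (k : ℕ) (hk : 3 ≤ k) {c : ℚ}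
    (hc : c ∈ Set.range (fun j : ℕ => (2 : ℚ) ^ j)) :
    ∀ φ : P1FiniteMap, 0 < φ.deg → φ.num.natDegree = φ.deg → φ.den.natDegree = φ.deg →
      (φ.num - φ.den).natDegree = φ.deg →
      (∀ a ∈ DeCrit.critSetC k c, aeval a (φ.num * φ.den * (φ.num - φ.den)) = 0) →
      ((φ.num * φ.den * (φ.num - φ.den)).map (Int.castRingHom ℂ)).roots.toFinset.card
        ≤ φ.deg + 2 →
      ∀ (K : Type) [Field K] [NumberField K], (DeCrit.RpolyC k (c : K)).Splits →
      ((φ.num * φ.den * (φ.num - φ.den)).map (Int.castRingHom K)).Splits →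
      ∀ (Nd : ℕ) (ρ : ℝ), 0 < ρ → ∃ C₂ : ℝ, ∀ (L : Type) [Field L] [NumberField L] [Algebra K L],
        Module.finrank ℚ L ≤ Nd → ∀ (x r : L),
        r ^ (2 * k + 1) = x * (1 - x) → x ≠ 0 → x ≠ 1 → r ≠ 0 → 1 - 2 * x ≠ 0 →
        ((φ.num * φ.den * (φ.num - φ.den)).map (Int.castRingHom L)).Splits →
        aeval (DeCrit.tC k (algebraMap ℚ L c) x r) (φ.num * φ.den * (φ.num - φ.den)) ≠ 0 →
        (∀ σ : L →+* ℂ, ∀ a ∈ (resultant (De.curvePoly k) (De.homFibrePolyC k c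
          (φ.num.map (Int.castRingHom ℚ) * φ.den.map (Int.castRingHom ℚ) *
            (φ.num.map (Int.castRingHom ℚ) - φ.den.map (Int.castRingHom ℚ))))).aroots ℂ,
          ρ < ‖σ x - a‖) →
        (∀ σ : L →+* PadicAlgCl 2, ∀ a ∈ (resultant (De.curvePoly k) (De.homFibrePolyC k c
          (φ.num.map (Int.castRingHom ℚ) * φ.den.map (Int.castRingHom ℚ) *
            (φ.num.map (Int.castRingHom ℚ) - φ.den.map (Int.castRingHom ℚ))))).aroots
            (PadicAlgCl 2), ρ < ‖σ x - a‖) →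
        (⟨L, DeCrit.tC k (algebraMap ℚ L c) x r⟩ : NFPoint).logCondDiv φ.pullbackCusps ≤
          ((φ.deg + 2 : ℝ) * (2 * k + 4) - (6 * k + 6)) / (2 * k + 1) * (⟨L, x⟩ : NFPoint).ht
            + C₂ := by
  have hk1 : 1 ≤ k := by omega
  have hc0 : c ≠ 0 := by
    obtain ⟨j, hj⟩ := hc
    rw [← hj]
    exact pow_ne_zero _ two_ne_zero
  intro φ hdeg hnum hden hsub hAB hcard K _ _ hKR hKB Nd _ρ hρ
  exact exists_condBound_mechanism k hk1 hc0 φ hdeg hnum hden hsub hAB hcard K hKR hKB Nd hρ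

end Literature.NumberTheory.DiophantineGeometry.GenEll

end
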